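import Summits.QuantumFields.YangMills.Theorems.VirialFluxGapCentralFieldDefs
import Summits.QuantumFields.YangMills.Theorems.VirialFluxGapFixFrameCount
import HarnessLib

/-!
# Route `VirialFluxGap` (YangMills): SUMS OVER THE `X_fix` FRAME pushed forward to the ring variables — `Σ_{v : FixVar L} g(fixVar v)` is the sum of `g`
# over all ring variables with the slice-0 comb-tree links removed (bookkeeping for the divergence count of the explicit central field)

Toward ⟨stmt-QuantumFields-24141⟩ `VirialFluxGap.PeriodicSoftness`.  The divergence clause of the central package is a sum over the standard frame
`ι = FixVar L × Fin 3` of `X_fix` (w2 g51 ✓`FixFrame`): `Σ_{va} ∂_{fixFrameStd va} C_va = Σ_{v : FixVar L} (Σ_a …)(fixVar v)`, while the per-variable traces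
of the explicit field (w3 g59 ✓`centralDiv_wrap_eq`, anchored profile ✓`slice_anchored_div`) are indexed by RING variables `w` and by the three-way branch of
✓`centralDir` (`slice-0 tree link ↦ 0`, `wrap link ↦ block slot`, `else ↦ plain slot`; seam sites).  This file is the change of index:

* ★★ `sum_fixVar_eq` — for any `g` on the ring variables,
  `Σ_{v : FixVar L} g (fixVar v) = (Σ_{(i,e)} if i = 0 ∧ treeEdge e then 0 else g (inl (i,e))) + Σ_x g (inr x)`
  (`fixVar` is a bijection onto the non-tree variables: ✓`fixVar_injective`, ✓`exists_fixVar_or_tree`, ✓`fixVar_ne_tree`);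
* `sum_fixVar_prod_eq` — the same for `Σ_{va : FixVar L × Fin 3} G va.1 va.2` with the inner `Σ_a` kept;
* `sum_wrap_indicator` — `Σ_{(i,e)} [e wrap ? d_{e.2} : 0] = Σ_k #wrapBlock k · d_k` (the wrap slots of block `k` are `#wrapBlock k` many, ✓`card_wrapBlock`);
* ★★ `sum_fixVar_le_of_slot_bounds` — THE BUDGET: if `T ≤ c − d_k` at every wrap slot of block `k`, `T ≤ c` at every other non-tree link slot and
  `T ≤ c − d_s` at every seam slot, then `Σ_{v : FixVar L} T (fixVar v) ≤ c·(6L⁴+1) − Σ_k #wrapBlock k · d_k − L³·d_s` (✓`card_fixVar`);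
* ★★ `centralDiv_le_of_slot_bounds` ∕ `centralDiv_le_budget` — the same for the divergence `Σ_{va} ∂_{fixFrameStd va}(centralCoeff σ σ₄ va)` of w3's explicit
  central field, per-slot hypotheses in the letters of ✓`centralDiv_wrap_eq` (`Σ_a frameD (stdFrame (w,a)) (M ↦ pauliCoord (centralDir σ σ₄ M w) a) M`); with the
  per-slot budgets `3 − (3/2)/N + 3ρ²/N` (✓`central_trace_le`; `N = #wrapBlock k`, resp. `L³`) and `3` (plain) the total is `≤ 18L⁴ − 3 + 12ρ²` (✓`budget_arith`),
  `≤ 18L⁴ − ½` once `ρ² ≤ 5/24`.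

HONEST FRAMING: index bookkeeping and one `Finset.sum_le_sum` (theorems only, 0 `def`, 0 `sorry`, standard axioms); no divergence is bounded here; ⟨24141⟩ and ⟨22884⟩ stay OPEN; no stub ∕
crux ∕ rung ∕ summit is closed; the Yang–Mills mass gap is NOT proved; no summit is proved by a line.  Width seat `ym-line-sfw-p2-w2` g52 (cell ym-idea-1,
free hands), `--supports stmt-QuantumFields-24141`.  References: [cite: SeilerLNP1982, §2] (tree gauge); [folklore].
-/

set_option autoImplicit false

noncomputable section

open scoped BigOperators
open Literature.MathematicalPhysics.QuantumFieldTheory hiding SU2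
open Literature.MathematicalPhysics.QuantumLattice

namespace Summit.QuantumFields.YangMills.Theorems.VirialFluxGap.FixFrame

open Summit.QuantumFields.YangMills.Theorems.FemtoTransferGap
open Summit.QuantumFields.YangMills.Theorems.FemtoTransferGap.TT
open Summit.QuantumFields.YangMills.Theorems.VirialFluxGap.FrameDerivative
open Summit.QuantumFields.YangMills.Theorems.VirialFluxGap.FrameHessian
open Summit.QuantumFields.YangMills.Theorems.VirialFluxGap.CentralField

variable {L : ℕ} [NeZero L]

/-! ## §1 The change of index `FixVar L → ring variables` -/

/-- The slice-0 part: summing over the off-tree links equals summing the tree-masked function over all links. [folklore] -/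
theorem sum_offIdx_eq_sum_ite {β : Type*} [AddCommMonoid β] (f : Edge 3 L → β) :
    ∑ e : OffIdx L, f e.1 = ∑ e : Edge 3 L, if treeEdge e = true then 0 else f e := by
  classical
  rw [← Finset.sum_subtype (Finset.univ.filter fun e : Edge 3 L => ¬ treeEdge e = true) (fun e => by simp), Finset.sum_filter]
  refine Finset.sum_congr rfl fun e _ => ?_
  by_cases ht : treeEdge e = true
  · simp [ht]
  · simp [ht]

/-- ★★ **Sums over the `X_fix` variables, pushed forward to the ring variables**: for any `g`,
`Σ_{v : FixVar L} g (fixVar v) = (Σ_{(i,e)} [i = 0 ∧ e on the comb tree ? 0 : g (inl (i,e))]) + Σ_x g (inr x)`. [cite: SeilerLNP1982, §2] -/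
theorem sum_fixVar_eq {β : Type*} [AddCommMonoid β] (g : ((Fin (2 * L - 1 + 1) × Edge 3 L) ⊕ Site 3 L) → β) :
    ∑ v : FixVar L, g (fixVar v) =
      (∑ ie : Fin (2 * L - 1 + 1) × Edge 3 L, if ie.1 = 0 ∧ treeEdge ie.2 = true then 0 else g (Sum.inl ie)) + ∑ x : Site 3 L, g (Sum.inr x) := by
  classical
  -- split the ring-variable sum by slice: slice `0` and the later slices
  have hD : (∑ ie : Fin (2 * L - 1 + 1) × Edge 3 L, if ie.1 = 0 ∧ treeEdge ie.2 = true then 0 else g (Sum.inl ie)) =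
      (∑ e : Edge 3 L, if treeEdge e = true then 0 else g (Sum.inl (0, e))) +
        ∑ j : Fin (2 * L - 1), ∑ e : Edge 3 L, g (Sum.inl (j.succ, e)) := by
    rw [Fintype.sum_prod_type, Fin.sum_univ_succ]
    congr 1; simp
  -- split the `X_fix` sum by the three kinds of variables
  have hA : ∑ v : FixVar L, g (fixVar v) =
      (∑ e : OffIdx L, g (Sum.inl (0, e.1))) + ((∑ je : Fin (2 * L - 1) × Edge 3 L, g (Sum.inl (je.1.succ, je.2))) + ∑ x : Site 3 L, g (Sum.inr x)) := by
    rw [Fintype.sum_sum_type, Fintype.sum_sum_type]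
    rfl
  have hB : ∑ je : Fin (2 * L - 1) × Edge 3 L, g (Sum.inl (je.1.succ, je.2)) = ∑ j : Fin (2 * L - 1), ∑ e : Edge 3 L, g (Sum.inl (j.succ, e)) :=
    Fintype.sum_prod_type' fun (j : Fin (2 * L - 1)) (e : Edge 3 L) => g (Sum.inl (j.succ, e))
  rw [hA, hD, sum_offIdx_eq_sum_ite (fun e => g (Sum.inl (0, e))), hB, add_assoc]

/-- The same with an inner sum over the three frame directions kept: `Σ_{va} G (fixVar va.1) va.2` pushed forward. [folklore] -/
theorem sum_fixVar_prod_eq {β : Type*} [AddCommMonoid β] (G : ((Fin (2 * L - 1 + 1) × Edge 3 L) ⊕ Site 3 L) → Fin 3 → β) :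
    ∑ va : FixVar L × Fin 3, G (fixVar va.1) va.2 =
      (∑ ie : Fin (2 * L - 1 + 1) × Edge 3 L, if ie.1 = 0 ∧ treeEdge ie.2 = true then 0 else ∑ a : Fin 3, G (Sum.inl ie) a) +
        ∑ x : Site 3 L, ∑ a : Fin 3, G (Sum.inr x) a := by
  rw [Fintype.sum_prod_type]
  exact sum_fixVar_eq (fun w => ∑ a : Fin 3, G w a)

/-! ## §2 Slot counts: wrap blocks and the seam -/

/-- The wrap block of direction `k` as a filter of all (slice, site) pairs. [folklore] -/
theorem filter_wrap_eq_wrapBlock (k : Fin 3) [DecidablePred fun ix : Fin (2 * L - 1 + 1) × Site 3 L => ix.2 k = -1] :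
    (Finset.univ.filter fun ix : Fin (2 * L - 1 + 1) × Site 3 L => ix.2 k = -1) = wrapBlock L k := by
  ext v
  rw [Finset.mem_filter, mem_wrapBlock]
  simp

/-- ★ **Wrap-slot count**: summing an indicator of the wrap links weighted by a per-direction constant over ALL (slice, link) pairs gives
`Σ_k #wrapBlock k · d_k`. [cite: SeilerLNP1982, §2] -/
theorem sum_wrap_indicator (d : Fin 3 → ℝ) :
    (∑ ie : Fin (2 * L - 1 + 1) × Edge 3 L, if ie.2.1 ie.2.2 = -1 then d ie.2.2 else 0) =
      ∑ k : Fin 3, ((wrapBlock L k).card : ℝ) * d k := by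
  classical
  have h1 : (∑ ie : Fin (2 * L - 1 + 1) × Edge 3 L, if ie.2.1 ie.2.2 = -1 then d ie.2.2 else 0) =
      ∑ i : Fin (2 * L - 1 + 1), ∑ k : Fin 3, ∑ x : Site 3 L, (if x k = -1 then d k else 0) := by
    rw [Fintype.sum_prod_type]
    refine Finset.sum_congr rfl fun i _ => ?_
    rw [Fintype.sum_prod_type, Finset.sum_comm]
  have h2 : ∀ k : Fin 3, (∑ i : Fin (2 * L - 1 + 1), ∑ x : Site 3 L, (if x k = -1 then d k else 0)) = ((wrapBlock L k).card : ℝ) * d k := by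
    intro k
    rw [← Fintype.sum_prod_type' (fun (i : Fin (2 * L - 1 + 1)) (x : Site 3 L) => if x k = -1 then d k else 0), ← Finset.sum_filter,
      Finset.sum_const, nsmul_eq_mul, filter_wrap_eq_wrapBlock k]
  rw [h1, Finset.sum_comm]
  exact Finset.sum_congr rfl fun k _ => h2 k

/-! ## §3 The budget: per-slot bounds ⇒ a bound on the `X_fix` frame sum -/

/-- ★★ **THE SLOT BUDGET.**  Let `T` be any real function of the ring variables.  If `T ≤ c − d_k` at every wrap slot `(i,(x,k))`, `x_k = −1`, of block `k`;
`T ≤ c` at every other link slot that is a variable of `X_fix` (not a slice-`0` comb-tree link, not a wrap link); and `T ≤ c − d_s` at every seam slot; then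
`Σ_{v : FixVar L} T (fixVar v) ≤ c·(6L⁴ + 1) − Σ_k #wrapBlock k · d_k − L³·d_s` (`#FixVar L = 6L⁴+1`, ✓`card_fixVar`; wrap links are never tree links,
✓`not_treeEdge_of_wrap`).  No sign conditions on `c, d_k, d_s`. [cite: SeilerLNP1982, §2] -/
theorem sum_fixVar_le_of_slot_bounds (T : ((Fin (2 * L - 1 + 1) × Edge 3 L) ⊕ Site 3 L) → ℝ) (c ds : ℝ) (dw : Fin 3 → ℝ)
    (hw : ∀ (i : Fin (2 * L - 1 + 1)) (x : Site 3 L) (k : Fin 3), x k = -1 → T (Sum.inl (i, (x, k))) ≤ c - dw k)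
    (hp : ∀ (i : Fin (2 * L - 1 + 1)) (e : Edge 3 L), ¬ (i = 0 ∧ treeEdge e = true) → ¬ e.1 e.2 = -1 → T (Sum.inl (i, e)) ≤ c)
    (hs : ∀ x : Site 3 L, T (Sum.inr x) ≤ c - ds) :
    ∑ v : FixVar L, T (fixVar v) ≤ c * (6 * (L : ℝ) ^ 4 + 1) - (∑ k : Fin 3, ((wrapBlock L k).card : ℝ) * dw k) - (L : ℝ) ^ 3 * ds := by
  classical
  -- the defect function `D` and the pointwise majorant `c − D`
  set D : ((Fin (2 * L - 1 + 1) × Edge 3 L) ⊕ Site 3 L) → ℝ :=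
    Sum.elim (fun ie => if ie.2.1 ie.2.2 = -1 then dw ie.2.2 else 0) (fun _ => ds) with hD
  have hDl : ∀ ie : Fin (2 * L - 1 + 1) × Edge 3 L, D (Sum.inl ie) = if ie.2.1 ie.2.2 = -1 then dw ie.2.2 else 0 := fun ie => rfl
  have hDr : ∀ x : Site 3 L, D (Sum.inr x) = ds := fun x => rfl
  have hle : ∀ v : FixVar L, T (fixVar v) ≤ c - D (fixVar v) := by
    have hlink : ∀ (i : Fin (2 * L - 1 + 1)) (e : Edge 3 L), ¬ (i = 0 ∧ treeEdge e = true) → T (Sum.inl (i, e)) ≤ c - D (Sum.inl (i, e)) := by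
      intro i e hm
      rw [hDl]
      by_cases hwr : e.1 e.2 = -1
      · rw [if_pos hwr]
        exact hw i e.1 e.2 hwr
      · rw [if_neg hwr, sub_zero]
        exact hp i e hm hwr
    rintro (e | je | x)
    · rw [fixVar_off]
      exact hlink 0 e.1 fun h => e.2 h.2
    · rw [fixVar_slice]
      exact hlink je.1.succ je.2 fun h => Fin.succ_ne_zero _ h.1
    · rw [fixVar_seam, hDr]
      exact hs x
  -- the defect sum, pushed to the ring variables
  have hmask : ∀ ie : Fin (2 * L - 1 + 1) × Edge 3 L, (if ie.1 = 0 ∧ treeEdge ie.2 = true then 0 else D (Sum.inl ie)) = D (Sum.inl ie) := by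
    intro ie
    by_cases hm : ie.1 = 0 ∧ treeEdge ie.2 = true
    · rw [if_pos hm, hDl, if_neg (fun hwr => not_treeEdge_of_wrap hwr hm.2)]
    · rw [if_neg hm]
  have hsumD : ∑ v : FixVar L, D (fixVar v) = (∑ k : Fin 3, ((wrapBlock L k).card : ℝ) * dw k) + (L : ℝ) ^ 3 * ds := by
    -- `#Site 3 L = L³` (✓`TwoLattice.Electric.card_site`, recomputed inline to keep the imports light)
    have hS : Fintype.card (Site 3 L) = L ^ 3 := by
      rw [Fintype.card_pi, Finset.prod_const, Finset.card_univ, Fintype.card_fin, ZMod.card]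
    rw [sum_fixVar_eq D, Finset.sum_congr rfl fun ie _ => hmask ie]
    simp only [hDl, hDr]
    rw [sum_wrap_indicator dw, Finset.sum_const, Finset.card_univ, hS, nsmul_eq_mul]
    push_cast
    ring
  -- assemble
  calc ∑ v : FixVar L, T (fixVar v) ≤ ∑ v : FixVar L, (c - D (fixVar v)) := Finset.sum_le_sum fun v _ => hle v
    _ = c * (6 * (L : ℝ) ^ 4 + 1) - (∑ k : Fin 3, ((wrapBlock L k).card : ℝ) * dw k) - (L : ℝ) ^ 3 * ds := by
      rw [Finset.sum_sub_distrib, Finset.sum_const, Finset.card_univ, card_fixVar, nsmul_eq_mul, hsumD]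
      push_cast
      ring

/-- The budget with the numerical per-slot constants of the explicit central field (✓`central_trace_le`: `3 − (3/2)/N + 3ρ²/N` at a wrap slot of block size
`N = #wrapBlock k` and at a seam slot, `N = L³`; `3` at a plain slot): the total is `≤ 18L⁴ − 3 + 12ρ²` (✓`budget_arith`). [cite: CosteEtAl1985] -/
theorem sum_fixVar_le_budget (T : ((Fin (2 * L - 1 + 1) × Edge 3 L) ⊕ Site 3 L) → ℝ) (ρ : ℝ)
    (hw : ∀ (i : Fin (2 * L - 1 + 1)) (x : Site 3 L) (k : Fin 3), x k = -1 →
      T (Sum.inl (i, (x, k))) ≤ 3 - (3 / 2) / ((wrapBlock L k).card : ℝ) + 3 * ρ ^ 2 / ((wrapBlock L k).card : ℝ))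
    (hp : ∀ (i : Fin (2 * L - 1 + 1)) (e : Edge 3 L), ¬ (i = 0 ∧ treeEdge e = true) → ¬ e.1 e.2 = -1 → T (Sum.inl (i, e)) ≤ 3)
    (hs : ∀ x : Site 3 L, T (Sum.inr x) ≤ 3 - (3 / 2) / (L : ℝ) ^ 3 + 3 * ρ ^ 2 / (L : ℝ) ^ 3) :
    ∑ v : FixVar L, T (fixVar v) ≤ 18 * (L : ℝ) ^ 4 - 3 + 12 * ρ ^ 2 := by
  have hL : (0 : ℝ) < (L : ℝ) ^ 3 := by
    have : (0 : ℝ) < L := Nat.cast_pos.2 (NeZero.pos L)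
    positivity
  have hN : ∀ k : Fin 3, (0 : ℝ) < ((wrapBlock L k).card : ℝ) := fun k => Nat.cast_pos.2 (Finset.card_pos.2 (wrapBlock_nonempty k))
  have h := sum_fixVar_le_of_slot_bounds T 3 ((3 / 2) / (L : ℝ) ^ 3 - 3 * ρ ^ 2 / (L : ℝ) ^ 3)
    (fun k => (3 / 2) / ((wrapBlock L k).card : ℝ) - 3 * ρ ^ 2 / ((wrapBlock L k).card : ℝ))
    (fun i x k hx => by linarith [hw i x k hx]) hp (fun x => by linarith [hs x])
  have hk : ∀ k : Fin 3, ((wrapBlock L k).card : ℝ) * ((3 / 2) / ((wrapBlock L k).card : ℝ) - 3 * ρ ^ 2 / ((wrapBlock L k).card : ℝ)) = 3 / 2 - 3 * ρ ^ 2 := by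
    intro k
    have hk0 : ((wrapBlock L k).card : ℝ) ≠ 0 := (hN k).ne'
    rw [← sub_div, mul_div_assoc', mul_div_cancel_left₀ _ hk0]
  have hsd : (L : ℝ) ^ 3 * ((3 / 2) / (L : ℝ) ^ 3 - 3 * ρ ^ 2 / (L : ℝ) ^ 3) = 3 / 2 - 3 * ρ ^ 2 := by
    rw [← sub_div, mul_div_assoc', mul_div_cancel_left₀ _ hL.ne']
  rw [Finset.sum_congr rfl fun k _ => hk k, Finset.sum_const, Finset.card_univ, Fintype.card_fin, nsmul_eq_mul, hsd] at h
  push_cast at h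
  linarith

/-! ## §4 The same for the divergence of the explicit central field in the standard `X_fix` frame -/

/-- The divergence sum of the explicit central field over the standard `X_fix` frame, re-indexed by the ring variables: with
`T w := Σ_a frameD (stdFrame (w,a)) (M ↦ pauliCoord (centralDir σ σ₄ M w) a) M` (the left side of ✓`centralDiv_wrap_eq`),
`Σ_{va : FixVar L × Fin 3} frameD (fixFrameStd va) (centralCoeff σ σ₄ va) M = Σ_{v : FixVar L} T (fixVar v)` (definitional unfolding of ✓`fixFrameStd`, ✓`centralCoeff`,
✓`fixCoord`). [folklore] -/
theorem sum_frameD_centralCoeff_eq (σ : Fin 3 → ℝ) (σ₄ : ℝ)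
    (M : (Fin (2 * L - 1 + 1) → Edge 3 L → Matrix (Fin 2) (Fin 2) ℂ) × (Site 3 L → Matrix (Fin 2) (Fin 2) ℂ)) :
    ∑ va : FixVar L × Fin 3, frameD (fixFrameStd va) (centralCoeff L σ σ₄ va) M =
      ∑ v : FixVar L, ∑ a : Fin 3, frameD (stdFrame (fixVar v, a)) (fun M' => pauliCoord (centralDir L σ σ₄ M' (fixVar v)) a) M := by
  rw [Fintype.sum_prod_type]
  rfl

/-- ★★ **The central divergence budget from per-slot bounds** (the bookkeeping step of clause (P3) of the central package): if at the coordinates `M`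
the per-variable traces `T w = Σ_a frameD (stdFrame (w,a)) (M ↦ pauliCoord (centralDir σ σ₄ M w) a) M` of the explicit central field obey `T ≤ c − d_k` at the
wrap slots of block `k`, `T ≤ c` at the plain slots (neither slice-`0` tree nor wrap — the third branch of ✓`centralDir`), `T ≤ c − d_s` at the seam slots, then
`Σ_{va} frameD (fixFrameStd va) (centralCoeff σ σ₄ va) M ≤ c(6L⁴+1) − Σ_k #wrapBlock k·d_k − L³ d_s`. [cite: CosteEtAl1985] -/
theorem centralDiv_le_of_slot_bounds (σ : Fin 3 → ℝ) (σ₄ : ℝ)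
    (M : (Fin (2 * L - 1 + 1) → Edge 3 L → Matrix (Fin 2) (Fin 2) ℂ) × (Site 3 L → Matrix (Fin 2) (Fin 2) ℂ)) (c ds : ℝ) (dw : Fin 3 → ℝ)
    (hw : ∀ (i : Fin (2 * L - 1 + 1)) (x : Site 3 L) (k : Fin 3), x k = -1 →
      ∑ a : Fin 3, frameD (stdFrame (Sum.inl (i, (x, k)), a)) (fun M' => pauliCoord (centralDir L σ σ₄ M' (Sum.inl (i, (x, k)))) a) M ≤ c - dw k)
    (hp : ∀ (i : Fin (2 * L - 1 + 1)) (e : Edge 3 L), ¬ (i = 0 ∧ treeEdge e = true) → ¬ e.1 e.2 = -1 →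
      ∑ a : Fin 3, frameD (stdFrame (Sum.inl (i, e), a)) (fun M' => pauliCoord (centralDir L σ σ₄ M' (Sum.inl (i, e))) a) M ≤ c)
    (hs : ∀ x : Site 3 L, ∑ a : Fin 3, frameD (stdFrame (Sum.inr x, a)) (fun M' => pauliCoord (centralDir L σ σ₄ M' (Sum.inr x)) a) M ≤ c - ds) :
    ∑ va : FixVar L × Fin 3, frameD (fixFrameStd va) (centralCoeff L σ σ₄ va) M ≤
      c * (6 * (L : ℝ) ^ 4 + 1) - (∑ k : Fin 3, ((wrapBlock L k).card : ℝ) * dw k) - (L : ℝ) ^ 3 * ds := by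
  rw [sum_frameD_centralCoeff_eq]
  exact sum_fixVar_le_of_slot_bounds (fun w => ∑ a : Fin 3, frameD (stdFrame (w, a)) (fun M' => pauliCoord (centralDir L σ σ₄ M' w) a) M) c ds dw hw hp hs

/-- ★★ **The numerical central divergence budget**: with the per-slot bounds `3 − (3/2)/N + 3ρ²/N` at the wrap slots (`N = #wrapBlock k`) and at the seam slots
(`N = L³`) — the conclusion of ✓`central_trace_le` — and `3` at the plain slots, `Σ_{va} frameD (fixFrameStd va) (centralCoeff σ σ₄ va) M ≤ 18L⁴ − 3 + 12ρ²`;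
in particular `≤ 18L⁴ − ½` as soon as `ρ² ≤ 5/24` (e.g. `ρ ≤ 0.45`). [cite: CosteEtAl1985] -/
theorem centralDiv_le_budget (σ : Fin 3 → ℝ) (σ₄ : ℝ)
    (M : (Fin (2 * L - 1 + 1) → Edge 3 L → Matrix (Fin 2) (Fin 2) ℂ) × (Site 3 L → Matrix (Fin 2) (Fin 2) ℂ)) (ρ : ℝ)
    (hw : ∀ (i : Fin (2 * L - 1 + 1)) (x : Site 3 L) (k : Fin 3), x k = -1 →
      ∑ a : Fin 3, frameD (stdFrame (Sum.inl (i, (x, k)), a)) (fun M' => pauliCoord (centralDir L σ σ₄ M' (Sum.inl (i, (x, k)))) a) M ≤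
        3 - (3 / 2) / ((wrapBlock L k).card : ℝ) + 3 * ρ ^ 2 / ((wrapBlock L k).card : ℝ))
    (hp : ∀ (i : Fin (2 * L - 1 + 1)) (e : Edge 3 L), ¬ (i = 0 ∧ treeEdge e = true) → ¬ e.1 e.2 = -1 →
      ∑ a : Fin 3, frameD (stdFrame (Sum.inl (i, e), a)) (fun M' => pauliCoord (centralDir L σ σ₄ M' (Sum.inl (i, e))) a) M ≤ 3)
    (hs : ∀ x : Site 3 L, ∑ a : Fin 3, frameD (stdFrame (Sum.inr x, a)) (fun M' => pauliCoord (centralDir L σ σ₄ M' (Sum.inr x)) a) M ≤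
      3 - (3 / 2) / (L : ℝ) ^ 3 + 3 * ρ ^ 2 / (L : ℝ) ^ 3) :
    ∑ va : FixVar L × Fin 3, frameD (fixFrameStd va) (centralCoeff L σ σ₄ va) M ≤ 18 * (L : ℝ) ^ 4 - 3 + 12 * ρ ^ 2 ∧
      (ρ ^ 2 ≤ 5 / 24 → ∑ va : FixVar L × Fin 3, frameD (fixFrameStd va) (centralCoeff L σ σ₄ va) M ≤ 18 * (L : ℝ) ^ 4 - 1 / 2) := by
  have h : ∑ va : FixVar L × Fin 3, frameD (fixFrameStd va) (centralCoeff L σ σ₄ va) M ≤ 18 * (L : ℝ) ^ 4 - 3 + 12 * ρ ^ 2 := by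
    rw [sum_frameD_centralCoeff_eq]
    exact sum_fixVar_le_budget (fun w => ∑ a : Fin 3, frameD (stdFrame (w, a)) (fun M' => pauliCoord (centralDir L σ σ₄ M' w) a) M) ρ hw hp hs
  exact ⟨h, fun hρ => by linarith⟩

end Summit.QuantumFields.YangMills.Theorems.VirialFluxGap.FixFrame

end
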